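import Literature.IUT.LogVolume.ArchimedeanPacketLogVolume
import Literature.IUT.LogVolume.HolomorphicHull
import Literature.IUT.LogVolume.Theorem110LocalBounds
import Literature.IUT.LogVolume.ArchimedeanVolume
import HarnessLib

/-!
# [IUTchIV] Theorem 1.10, Step (vii): the holomorphic hull at an archimedean place is the container
# `π^{j+1}·B_I`, of log-volume exactly `(j+1)·log(π)`

Mochizuki, *Inter-universal Teichmüller theory IV*, RIMS manuscript (Apr. 2020; = PRIMS **57** (2021)),
proof of Thm. 1.10, Step (vii), p. 30 ("`π^{j+1}·B_I` serves as a container for the “union of possible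
images of a Θ-pilot object” … an upper bound `(j+1)·log(π)`"), read together with [IUTchIII] Rmk. 3.9.5
(i) (kurims p. 127: the holomorphic hull of `U` = the smallest `λ·𝒪 ⊇ U` relative to the direct sum
decomposition into fields — the tree's `Literature.IUT.LogVolume.holomorphicHull`, a polydisc of the radii
`sup_{u∈U} ‖u_j‖`, S2's `HolomorphicHull.lean`).

PROVED here (proof-only, classical): in the coordinates `Φ : M_I ≅ₐ[ℝ] ⊕_{j∈J} ℂ` of any direct sum
decomposition, for every region `U ⊆ M_I` lying in the container `π^{|I|}·B_I` and containing the tensor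
`⊗_i (π)_v` of the log-shell elements of maximal length (as the "union of possible images" does: it
contains all tensors of log-shell elements, p. 30), the holomorphic hull of `Φ(U)` IS `Φ(π^{|I|}·B_I)`, the
polydisc of common radius `π^{|I|}` (`holomorphicHull_image_eq`), and its normalised log-volume is EXACTLY
`|I|·log(π)` (`nlogVol_holomorphicHull_image`; `|I| = j+1`). Also: the dictionary between this file's
`ArchPacket.polydisc`/`unitBall` and S2's `polydisc` (`polydisc_eq`, `smul_unitBall_eq_polydisc`).
Nothing here takes a side on [IUTchIII] Cor. 3.12.
-/

noncomputable section

namespace Literature.IUT.LogVolume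

namespace ArchPacket

open MeasureTheory Set Metric Bornology
open scoped ENNReal Pointwise

variable (J : Type) [Fintype J]

omit [Fintype J] in
/-- This file's polydisc is S2's `polydisc` for the constant family `K_j = ℂ`.
[claim: Mochizuki2012, status: disputed] -/
theorem polydisc_eq (r : J → ℝ) : ArchPacket.polydisc J r = LogVolume.polydisc (fun _ : J => ℂ) r := by
  ext y
  rw [LogVolume.mem_polydisc]
  rfl

/-- `r·B` is S2's polydisc of constant radius `r` (`r ≥ 0`). [claim: Mochizuki2012, status: disputed] -/
theorem smul_unitBall_eq_polydisc [Nonempty J] {r : ℝ} (hr : 0 ≤ r) :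
    r • unitBall J = LogVolume.polydisc (fun _ : J => ℂ) fun _ => r := by
  rw [smul_unitBall J hr, polydisc_eq]

/-- **Bridge to the printed recipe**: on a hull-set `⊕_j r_j·𝒪` (`r_j > 0`) the normalised log-volume IS
the normalized-weight sum (here: the average) of the RADIAL log-volumes `μ̇^log(r_j) = log r_j` of
[AbsTopIII] Prop. 5.7 (ii)(b) on the summands (the tree's `radialMulLogVolume`, `ArchimedeanVolume.lean`)
— i.e. [IUTchIII] Prop. 3.9 (i), archimedean case, pp. 115–116: "the sum of the radial log-volumes on
each of the direct summand complex archimedean fields … [with] normalized weights".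
[claim: Mochizuki2012, status: disputed] -/
theorem nlogVol_polydisc_eq_avg_radialMulLogVolume [Nonempty J] {r : J → ℝ} (hr : ∀ j, 0 < r j) :
    nlogVol J (ArchPacket.polydisc J r) =
      (Fintype.card J : ℝ)⁻¹ * ∑ j, radialMulLogVolume ((r j : ℝ) : ℂ) := by
  rw [nlogVol_polydisc J hr]
  congr 1
  refine Finset.sum_congr rfl fun j _ => ?_
  rw [radialMulLogVolume_eq, Complex.norm_real, Real.norm_eq_abs, abs_of_pos (hr j)]

/-- **Radii pinned**: if `U` lies in the polydisc of constant radius `R ≥ 0` and contains a point all of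
whose coordinates have absolute value `R`, then every hull radius of `U` equals `R`.
[claim: Mochizuki2012, status: disputed] -/
theorem hullRadius_eq_of_subset_of_mem {U : Set (J → ℂ)} {R : ℝ} (hR : 0 ≤ R)
    (hU : U ⊆ LogVolume.polydisc (fun _ : J => ℂ) fun _ => R) {u : J → ℂ} (hu : u ∈ U)
    (huR : ∀ j, ‖u j‖ = R) (j : J) : hullRadius (fun _ : J => ℂ) U j = R := by
  refine le_antisymm (hullRadius_le_of_subset_polydisc (fun _ : J => ℂ) (fun _ => hR) hU j) ?_
  rw [← huR j]
  exact norm_apply_le_hullRadius (fun _ : J => ℂ)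
    ((isBounded_polydisc (fun _ : J => ℂ) _).subset hU) hu j

/-- Hence the holomorphic hull of such a `U` is the polydisc of constant radius `R` itself.
[claim: Mochizuki2012, status: disputed] -/
theorem holomorphicHull_eq_polydisc_of_subset_of_mem {U : Set (J → ℂ)} {R : ℝ} (hR : 0 ≤ R)
    (hU : U ⊆ LogVolume.polydisc (fun _ : J => ℂ) fun _ => R) {u : J → ℂ} (hu : u ∈ U)
    (huR : ∀ j, ‖u j‖ = R) :
    holomorphicHull (fun _ : J => ℂ) U = LogVolume.polydisc (fun _ : J => ℂ) fun _ => R := by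
  rw [holomorphicHull_of_isBounded (fun _ : J => ℂ) ((isBounded_polydisc (fun _ : J => ℂ) _).subset hU)]
  congr 1
  funext j
  exact hullRadius_eq_of_subset_of_mem J hR hU hu huR j

end ArchPacket

namespace Prop15iii

open MeasureTheory Set ArchPacket PiTensorProduct
open scoped ENNReal Pointwise

variable {I V : Type} [Fintype I] {J : Type}

/-- The tensor `⊗_i (r)_{v}` of the constant vectors of length `r ≥ 0` has every coordinate of absolute
value `r^{|I|}` (its coordinates are the characters `∏_i cj(·)(r) = r^{|I|}`).
[claim: Mochizuki2012, status: disputed] -/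
theorem norm_coord_tprod_const [DecidableEq I] [Fintype V] [DecidableEq V] (Φ : Decomposition I V J) {r : ℝ} (hr : 0 ≤ r) (j : J) :
    ‖Φ (tprod ℝ fun (_ : I) (_ : V) => (r : ℂ)) j‖ = r ^ Fintype.card I := by
  obtain ⟨w, hw⟩ := norm_coord_tprod Φ j (fun (_ : I) (_ : V) => (r : ℂ))
  rw [hw]
  simp [Complex.norm_real, Real.norm_eq_abs, abs_of_nonneg hr, Finset.prod_const, Finset.card_univ]

/-- The container in coordinates: `Φ(π^{|I|}·B_I)` is the polydisc of constant radius `π^{|I|}`.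
[claim: Mochizuki2012, status: disputed] -/
theorem image_pi_pow_smul_ball [Fintype J] [Nonempty J] (Φ : Decomposition I V J) :
    (Φ : MI I V → (J → ℂ)) '' (Real.pi ^ Fintype.card I • ball Φ) =
      LogVolume.polydisc (fun _ : J => ℂ) fun _ => Real.pi ^ Fintype.card I := by
  rw [image_smul_eq, image_ball, smul_unitBall_eq_polydisc J (pow_pos Real.pi_pos _).le]

/-- **Step (vii), hull form**: for every region `U ⊆ π^{|I|}·B_I` of `M_I` containing the tensor of the
log-shell elements of maximal length `π` (e.g. the "union of possible images", which contains ALL tensors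
of log-shell elements, p. 30), the holomorphic hull of `Φ(U)` is the container `Φ(π^{|I|}·B_I)`.
[claim: Mochizuki2012, status: disputed] -/
theorem holomorphicHull_image_eq [DecidableEq I] [Fintype V] [DecidableEq V] [Fintype J] [Nonempty J] (Φ : Decomposition I V J) {U : Set (MI I V)}
    (hU : U ⊆ Real.pi ^ Fintype.card I • ball Φ)
    (hmem : (tprod ℝ fun (_ : I) (_ : V) => (Real.pi : ℂ)) ∈ U) :
    holomorphicHull (fun _ : J => ℂ) ((Φ : MI I V → (J → ℂ)) '' U) =
      (Φ : MI I V → (J → ℂ)) '' (Real.pi ^ Fintype.card I • ball Φ) := by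
  rw [image_pi_pow_smul_ball Φ]
  refine holomorphicHull_eq_polydisc_of_subset_of_mem J (pow_pos Real.pi_pos _).le ?_
    (mem_image_of_mem _ hmem) (norm_coord_tprod_const Φ Real.pi_pos.le)
  rw [← image_pi_pow_smul_ball Φ]
  exact image_mono hU

/-- **Step (vii), the number**: the normalised log-volume of that holomorphic hull is EXACTLY
`|I|·log(π)` ("Such an upper bound `(j+1)·log(π)` follows immediately from the fact that … the log-volume
of `B_I` is equal to `0`", p. 30; `|I| = j+1`). [claim: Mochizuki2012, status: disputed] -/
theorem nlogVol_holomorphicHull_image [DecidableEq I] [Fintype V] [DecidableEq V] [Fintype J]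
    [Nonempty J] (Φ : Decomposition I V J) {U : Set (MI I V)}
    (hU : U ⊆ Real.pi ^ Fintype.card I • ball Φ)
    (hmem : (tprod ℝ fun (_ : I) (_ : V) => (Real.pi : ℂ)) ∈ U) :
    nlogVol J (holomorphicHull (fun _ : J => ℂ) ((Φ : MI I V → (J → ℂ)) '' U)) =
      Fintype.card I * Real.log Real.pi := by
  rw [holomorphicHull_image_eq Φ hU hmem]
  exact packetLogVol_pi_pow_smul_ball Φ

/-- The same with `|I| = j + 1` literally: `(j+1)·log(π)`. [claim: Mochizuki2012, status: disputed] -/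
theorem nlogVol_holomorphicHull_image_of_card [DecidableEq I] [Fintype V] [DecidableEq V] [Fintype J]
    [Nonempty J] (Φ : Decomposition I V J) {U : Set (MI I V)}
    {j : ℕ} (hI : Fintype.card I = j + 1) (hU : U ⊆ Real.pi ^ (j + 1) • ball Φ)
    (hmem : (tprod ℝ fun (_ : I) (_ : V) => (Real.pi : ℂ)) ∈ U) :
    nlogVol J (holomorphicHull (fun _ : J => ℂ) ((Φ : MI I V → (J → ℂ)) '' U)) =
      ((j : ℝ) + 1) * Real.log Real.pi := by
  rw [← hI] at hU
  rw [nlogVol_holomorphicHull_image Φ hU hmem, hI]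
  push_cast
  ring

/-- **Step (vii), upper-bound form for sub-regions**: ANY `U ⊆ π^{|I|}·B_I` (no membership hypothesis) has
holomorphic hull inside the container, hence — if the hull has positive volume, i.e. `U` is nondegenerate
— normalised log-volume `≤ |I|·log(π)`. [claim: Mochizuki2012, status: disputed] -/
theorem nlogVol_holomorphicHull_image_le [Fintype J] [Nonempty J] (Φ : Decomposition I V J) {U : Set (MI I V)}
    (hU : U ⊆ Real.pi ^ Fintype.card I • ball Φ)
    (h0 : volume (holomorphicHull (fun _ : J => ℂ) ((Φ : MI I V → (J → ℂ)) '' U)) ≠ 0) :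
    nlogVol J (holomorphicHull (fun _ : J => ℂ) ((Φ : MI I V → (J → ℂ)) '' U)) ≤
      Fintype.card I * Real.log Real.pi := by
  have hH : IsHullSet (fun _ : J => ℂ)
      (LogVolume.polydisc (fun _ : J => ℂ) fun _ => Real.pi ^ Fintype.card I) := by
    refine ⟨fun _ => ((Real.pi ^ Fintype.card I : ℝ) : ℂ), fun _ => ?_, ?_⟩
    · show ((Real.pi ^ Fintype.card I : ℝ) : ℂ) ≠ 0
      exact_mod_cast (pow_pos Real.pi_pos _).ne'
    · rw [hullSet]
      congr 1
      funext j
      rw [Complex.norm_real, Real.norm_eq_abs, abs_of_pos (pow_pos Real.pi_pos _)]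
  have hsub : holomorphicHull (fun _ : J => ℂ) ((Φ : MI I V → (J → ℂ)) '' U) ⊆
      (Φ : MI I V → (J → ℂ)) '' (Real.pi ^ Fintype.card I • ball Φ) := by
    rw [image_pi_pow_smul_ball Φ]
    refine holomorphicHull_subset_of_isHullSet (fun _ : J => ℂ) hH ?_
    rw [← image_pi_pow_smul_ball Φ]
    exact image_mono hU
  have htop : volume ((Φ : MI I V → (J → ℂ)) '' (Real.pi ^ Fintype.card I • ball Φ)) ≠ ∞ := by
    rw [image_smul_eq, image_ball, smul_unitBall J (pow_pos Real.pi_pos _).le]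
    exact (volume_polydisc_lt_top J _).ne
  calc nlogVol J (holomorphicHull (fun _ : J => ℂ) ((Φ : MI I V → (J → ℂ)) '' U))
      ≤ nlogVol J ((Φ : MI I V → (J → ℂ)) '' (Real.pi ^ Fintype.card I • ball Φ)) :=
        nlogVol_mono J hsub h0 htop
    _ = Fintype.card I * Real.log Real.pi := packetLogVol_pi_pow_smul_ball Φ

/-! ## The minimal instance: the tensors of log-shell elements themselves (non-vacuity of the hypotheses) -/

/-- The set of tensors `⊗_i m_i` of elements all of whose `ℂ_v`-components have length `≤ π` ("the
elements of `M_I` obtained by forming the tensor product of elements of the log-shells", p. 30).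
[claim: Mochizuki2012, status: disputed] -/
theorem tensors_subset_container [DecidableEq I] [Fintype V] [DecidableEq V] (Φ : Decomposition I V J) :
    (PiTensorProduct.tprod ℝ '' {m : I → M V | ∀ i v, ‖m i v‖ ≤ Real.pi}) ⊆ Real.pi ^ Fintype.card I • ball Φ := by
  rintro _ ⟨m, hm, rfl⟩
  exact tprod_mem_pi_pow_smul_ball Φ m hm

omit [Fintype I] in
/-- The maximal log-shell tensor `⊗_i (π)_v` belongs to that set. [claim: Mochizuki2012, status: disputed] -/
theorem tprod_const_pi_mem_tensors :
    (tprod ℝ fun (_ : I) (_ : V) => (Real.pi : ℂ)) ∈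
      (PiTensorProduct.tprod ℝ '' {m : I → M V | ∀ i v, ‖m i v‖ ≤ Real.pi}) :=
  ⟨fun _ _ => (Real.pi : ℂ), fun _ _ => by
    rw [Complex.norm_real, Real.norm_eq_abs, abs_of_pos Real.pi_pos], rfl⟩

/-- **Step (vii) for the set of log-shell tensors itself** (the hypotheses of `holomorphicHull_image_eq` are
met; no vacuity): its holomorphic hull is the container and has normalised log-volume `|I|·log(π)`.
[claim: Mochizuki2012, status: disputed] -/
theorem nlogVol_holomorphicHull_tensors [DecidableEq I] [Fintype V] [DecidableEq V] [Fintype J] [Nonempty J]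
    (Φ : Decomposition I V J) :
    nlogVol J (holomorphicHull (fun _ : J => ℂ)
        ((Φ : MI I V → (J → ℂ)) '' (PiTensorProduct.tprod ℝ '' {m : I → M V | ∀ i v, ‖m i v‖ ≤ Real.pi}))) =
      Fintype.card I * Real.log Real.pi :=
  nlogVol_holomorphicHull_image Φ (tensors_subset_container Φ) tprod_const_pi_mem_tensors

/-! ## The procession-normalised archimedean term (Steps (vii)–(viii)) -/

/-- **Step (vii) ⟹ the archimedean summand of Step (viii), as an EQUALITY**: for a procession of
collections indexed by `j ∈ {1, …, l⋇}` with `|I_j| = j+1`, decompositions `Φ_j` and regions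
`U_j ⊆ π^{j+1}·B_{I_j}` containing the maximal log-shell tensor, the procession average
(`Thm110Local.procAvg`, S3) of the log-volumes of the holomorphic hulls is `(1/l⋇)·Σ_j (j+1)·log(π)` — the
quantity the cell's Thm. 1.10 assembly carries as the hypothesis `arch ≤ procAvg_j (j+1)·log(π)`
(abc-iut-S2 `LDHLocalProofData`, abc-iut-S3 `LocalProofDataAvg.negLogTheta_le`), p. 30: "One may then
compute a “weighted average upper bound” and then a “procession-normalized upper bound”, as was done in
Step (v)." [claim: Mochizuki2012, status: disputed] -/
theorem procAvg_nlogVol_holomorphicHull_eq [Fintype V] [DecidableEq V] {lh : ℕ} (Ix Jx : ℕ → Type)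
    [∀ j, Fintype (Ix j)] [∀ j, DecidableEq (Ix j)] [∀ j, Fintype (Jx j)] [∀ j, Nonempty (Jx j)]
    (Φ : ∀ j, Decomposition (Ix j) V (Jx j)) (U : ∀ j, Set (MI (Ix j) V))
    (hcard : ∀ j, 1 ≤ j → j ≤ lh → Fintype.card (Ix j) = j + 1)
    (hU : ∀ j, 1 ≤ j → j ≤ lh → U j ⊆ Real.pi ^ (j + 1) • ball (Φ j))
    (hmem : ∀ j, 1 ≤ j → j ≤ lh → (tprod ℝ fun (_ : Ix j) (_ : V) => (Real.pi : ℂ)) ∈ U j) :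
    Thm110Local.procAvg lh
        (fun j => nlogVol (Jx j) (holomorphicHull (fun _ : Jx j => ℂ)
          ((Φ j : MI (Ix j) V → (Jx j → ℂ)) '' U j))) =
      Thm110Local.procAvg lh (fun j => ((j : ℝ) + 1) * Real.log Real.pi) := by
  unfold Thm110Local.procAvg
  congr 1
  refine Finset.sum_congr rfl fun j hj => ?_
  rw [Finset.mem_Icc] at hj
  exact nlogVol_holomorphicHull_image_of_card (Φ j) (hcard j hj.1 hj.2) (hU j hj.1 hj.2) (hmem j hj.1 hj.2)

/-- The same as the INEQUALITY `arch ≤ procAvg_j (j+1)·log(π)` consumed by the assembly (`harch` of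
abc-iut-S2's `DHData.localProofDataAvgOfDH`; then `(l+5)/4·log(π) ≤ (l+1)/4·4`, S3 `procAvg_arch`, p. 30).
[claim: Mochizuki2012, status: disputed] -/
theorem procAvg_nlogVol_holomorphicHull_le [Fintype V] [DecidableEq V] {lh : ℕ} (Ix Jx : ℕ → Type)
    [∀ j, Fintype (Ix j)] [∀ j, DecidableEq (Ix j)] [∀ j, Fintype (Jx j)] [∀ j, Nonempty (Jx j)]
    (Φ : ∀ j, Decomposition (Ix j) V (Jx j)) (U : ∀ j, Set (MI (Ix j) V))
    (hcard : ∀ j, 1 ≤ j → j ≤ lh → Fintype.card (Ix j) = j + 1)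
    (hU : ∀ j, 1 ≤ j → j ≤ lh → U j ⊆ Real.pi ^ (j + 1) • ball (Φ j))
    (hmem : ∀ j, 1 ≤ j → j ≤ lh → (tprod ℝ fun (_ : Ix j) (_ : V) => (Real.pi : ℂ)) ∈ U j) :
    Thm110Local.procAvg lh
        (fun j => nlogVol (Jx j) (holomorphicHull (fun _ : Jx j => ℂ)
          ((Φ j : MI (Ix j) V → (Jx j → ℂ)) '' U j))) ≤
      Thm110Local.procAvg lh (fun j => ((j : ℝ) + 1) * Real.log Real.pi) :=
  (procAvg_nlogVol_holomorphicHull_eq Ix Jx Φ U hcard hU hmem).le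

end Prop15iii

end Literature.IUT.LogVolume

end
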